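/-
Copyright (c) 2026. All rights reserved.
Released under Apache 2.0 license as described in the file LICENSE.
Authors: abc-iut cell — seat abc-iut-w4-d071 (wave 4, gen 4; row «T54·hcof-free-rebind (integrated)», L3 lead α101),
after abc-iut-w4-d089 gen 6 (p442343, the hAcof form this file supersedes).
-/
import Literature.AnabelianGeometry.SemiGraphs.ArithThm54IntegratedChartCongruence
import Literature.AnabelianGeometry.SemiGraphs.ArithBranchPairAugChartModKernel
import Literature.AnabelianGeometry.SemiGraphs.ArithLevelCofinalityOuterAction
import Literature.AnabelianGeometry.SemiGraphs.ArithLevelKernelVertexLift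
import Literature.AnabelianGeometry.SemiGraphs.ArithVertGpCompact
import HarnessLib

/-!
# [SemiAnbd] THEOREM 5.4 (i) ∧ (ii) ∧ (iii) at the outer models, INTEGRATED — (AI4″) bound to the hcof-FREE producer,
# with `hVc`, `hUclosed`, `hU` DISCHARGED as terms (corollary-integrator rebind «hcof-free-rebind»; proof-only)

Mochizuki, *Semi-graphs of anabelioids*, Publ. RIMS **42** (2006) 221–322, §5 Def 5.1 (i) p. 62, Prop 5.2 (iv) p. 64,
Rmk 5.3.1 p. 65, Thm 5.4 (i)(ii)(iii) p. 66; §3 proof of Thm 3.7 (iii) p. 41 [cite: MochizukiSemiAnbd2006, Thm 5.4, p. 66].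

PROOF-ONLY file (abc-iut cell, layer L3, sub-DAG `plan/L3/SUBDAG-SemiAnbd-Thm54.md`, producer row T54-B; row
«T54·hcof-free-rebind», seat abc-iut-w4-d071 gen 4, L3 lead α101).  No definition, no new named fact, no producer
restated.  This is abc-iut-w4-d089's `arithThm54_outerModels_chart_of_producers_of_congruenceContinuous_aug`
(ArithThm54IntegratedChartAug.lean, p442343) with the (AI4″) binder `stabBranchPairAug` supplied on each side by
abc-iut-w4-d059's hcof-FREE chart producer `stabBranchPairAug_chart_outerAction_modKernel`
(ArithBranchPairAugChartModKernel.lean, p442253) instead of `stabBranchPairAug_chart_outerAction`, and with THREE of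
that producer's inputs now TERMS of the tower data at the level-topology pin:

* `hVc` (the arithmetic vertex groups `Π^temp_{𝔊,v}` are compact — Rmk 5.3.1 p. 65) := abc-iut-w4-d059's
  `hVc_of_cosetTower` (ArithVertGpCompact.lean, p442845): a stabiliser of a compatible vertex system is closed,
  and compact in abc-iut-w6-d070's tempered level topology along its basis;
* `hUclosed` (the images in `Π_A` of the finite-level action kernels are closed) := abc-iut-w4-d085's
  `isClosed_map_ker_arithAct_arithLevelTopology` (ArithLevelCofinalityOuterAction.lean, p438510);
* `hU` (every `a ∈ U_∞ = ⋂ₙ aug (ker arithAct_n)` lifts to ONE element of `Π^temp_{𝔊,v₀}` acting trivially at EVERY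
  finite level — the coherent-lift form; NOT the struck «hUρ : U_∞ ≤ ker ρ», which is equivalent to `ρ = 1` at
  one-vertex edgeless data, `ArithLevelKernelEdgelessObstruction.lean` p441067) := abc-iut-w4-d085's
  `hU_arithVertGp_outerAction` (ArithLevelKernelVertexLift.lean, p442216), from the TREE levels `ker ρ_n` with
  `piPresentation_hHK`/`piPresentation_hlift`, abc-iut-L3-t9's Φ-stability
  (`hKst_and_hLst_of_ker_piLevelAut_eq_charOpenCore`) and compactness of `H_{v₀}`.

So `hAcof` («hfaith-arith»/hcof lane) is GONE from the theorem of record `…_aug_modKernel` (p442343 with, per side,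
`{hVc, hAcof}` ↦ ∅); the (AI4″) slot now costs only `{hRcV, hRcB}` and the frame `[CompactSpace Π_A] [T2Space Π_A]`.

HONEST RESIDUAL: p442343's minus `hVc`, `hAcof` on each side (per side: Cor39Hypotheses, finiteness, tower data hcof hS
hfin hne hconn, hker, hfaithV, design hV hE hopen hBR F θ hrep, T R Rc w d, n₀ hself hCC, hinst, noSwitchBase, hRcV hRcB,
hest hbot; across: btemp hcont hover hbtempφ, dict θd hlo φc hφc hfaith hfull hpre hpost, he).  Nothing beyond
composition is proved here; typed ≠ proved for the residual inputs; Thm 5.4 for OUR tower decompositions; no side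
taken on [IUTchIII] Cor. 3.12.
-/

namespace Literature.AnabelianGeometry.SemiGraphs

open _root_.CategoryTheory _root_.Topology _root_.Filter ProfiniteSemiGraph Literature.AnabelianGeometry.EtaleTheta
open scoped Pointwise

universe u v u₀

variable {Obj : Type u} [Category.{v} Obj] {𝓥 : SemiAnbdVocab.{u, v, u₀} Obj}
variable {𝔊 ℍ : ArithSemiGraph 𝓥} {e : 𝔊.PA ≃* ℍ.PA}
variable {𝒢 ℋ : ProfiniteSemiGraph.{u₀}}

/-- **[SemiAnbd] THEOREM 5.4 (i) ∧ (ii) ∧ (iii) at the outer models, INTEGRATED, (AI4″) bound to the hcof-FREE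
producer** `stabBranchPairAug_chart_outerAction_modKernel` (abc-iut-w4-d059), its `hN`, `haugc`, `hLopen`, `hnobpNCpt`
AND NOW `hVc`, `hUclosed`, `hU` bound by name to tree theorems under the level-topology pins (abc-iut-w4-d059 /
abc-iut-w4-d085); no arithmetic cofinality binder remains.  Residual: module docstring.
[cite: MochizukiSemiAnbd2006, Thm 5.4, p. 66] -/
theorem arithThm54_outerModels_chart_of_producers_of_congruenceContinuous_aug_modKernel
    -- ── the 𝔾 side: a cofinal Galois tower with characteristic levels, its chart, the outer model over `Π_A` ──
    (h39𝒢 : Cor39Hypotheses 𝒢) (D𝒢 : GaloisLevelData 𝒢)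
    (hcof𝒢 : ∀ (X : CovObj 𝒢), X.IsTempered → ∀ p : X.Point, ∃ i : ℕ, ∀ j, i ≤ j → (D𝒢.S j).Splits (X.component p))
    (hS𝒢 : ∀ n, (D𝒢.S n).Splits (D𝒢.S n)) (hfin𝒢 : ∀ n, (D𝒢.S n).IsFinite) (hne𝒢 : ∀ n, (D𝒢.S n).HasNonemptyFibres)
    (hconn𝒢 : ∀ (n : ℕ) (p q : (D𝒢.S n).Point), (D𝒢.S n).SameComponent p q)
    [Finite 𝒢.graph.Vertex] [Finite 𝒢.graph.Branch]
    [Finite 𝒢.graph.Edge]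
    (ρ𝒢 : 𝔊.PA →* TopOut (D𝒢.chart h39𝒢.toProp36Hypotheses.isCountable hcof𝒢 h39𝒢.toProp36Hypotheses.isConnected hS𝒢 hfin𝒢 hne𝒢).G) (baseAct𝒢 : 𝔊.PA →* Aut 𝒢.graph)
    [inst𝒢 : TopologicalSpace (outerSemidirectProduct ρ𝒢)]
    (T𝒢 : ∀ w : 𝒢.graph.Vertex, D𝒢.PointSeq h39𝒢.toProp36Hypotheses.isCountable w) (R𝒢 : SemiGraph.RefBranches 𝒢.graph)
    (Rc𝒢 : ChartRepresentatives (D𝒢.chart h39𝒢.toProp36Hypotheses.isCountable hcof𝒢 h39𝒢.toProp36Hypotheses.isConnected hS𝒢 hfin𝒢 hne𝒢))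
    -- Prop 3.6 (iv) at `ρ_𝔾(a)` / Def 5.1 (i)(c): the DESIGN data of the outer model (abc-iut-w4-d082's currency)
    (hV𝒢 : ∀ (a : 𝔊.PA) (v : 𝒢.graph.Vertex) (H : Subgroup (D𝒢.chart h39𝒢.toProp36Hypotheses.isCountable hcof𝒢 h39𝒢.toProp36Hypotheses.isConnected hS𝒢 hfin𝒢 hne𝒢).G), H ∈ verticialSubgroups (D𝒢.chart h39𝒢.toProp36Hypotheses.isCountable hcof𝒢 h39𝒢.toProp36Hypotheses.isConnected hS𝒢 hfin𝒢 hne𝒢) v →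
      ∃ φ : contMulAut (D𝒢.chart h39𝒢.toProp36Hypotheses.isCountable hcof𝒢 h39𝒢.toProp36Hypotheses.isConnected hS𝒢 hfin𝒢 hne𝒢).G, TopOut.mk _ φ = ρ𝒢 a ∧
        H.map (φ : MulAut (D𝒢.chart h39𝒢.toProp36Hypotheses.isCountable hcof𝒢 h39𝒢.toProp36Hypotheses.isConnected hS𝒢 hfin𝒢 hne𝒢).G).toMonoidHom ∈ verticialSubgroups (D𝒢.chart h39𝒢.toProp36Hypotheses.isCountable hcof𝒢 h39𝒢.toProp36Hypotheses.isConnected hS𝒢 hfin𝒢 hne𝒢) ((baseAct𝒢 a).hom.vertexMap v))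
    (hE𝒢 : ∀ (a : 𝔊.PA) (e : 𝒢.graph.Edge) (K : Subgroup (D𝒢.chart h39𝒢.toProp36Hypotheses.isCountable hcof𝒢 h39𝒢.toProp36Hypotheses.isConnected hS𝒢 hfin𝒢 hne𝒢).G), K ∈ edgeLikeSubgroups (D𝒢.chart h39𝒢.toProp36Hypotheses.isCountable hcof𝒢 h39𝒢.toProp36Hypotheses.isConnected hS𝒢 hfin𝒢 hne𝒢) e →
      ∃ φ : contMulAut (D𝒢.chart h39𝒢.toProp36Hypotheses.isCountable hcof𝒢 h39𝒢.toProp36Hypotheses.isConnected hS𝒢 hfin𝒢 hne𝒢).G, TopOut.mk _ φ = ρ𝒢 a ∧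
        K.map (φ : MulAut (D𝒢.chart h39𝒢.toProp36Hypotheses.isCountable hcof𝒢 h39𝒢.toProp36Hypotheses.isConnected hS𝒢 hfin𝒢 hne𝒢).G).toMonoidHom ∈ edgeLikeSubgroups (D𝒢.chart h39𝒢.toProp36Hypotheses.isCountable hcof𝒢 h39𝒢.toProp36Hypotheses.isConnected hS𝒢 hfin𝒢 hne𝒢) ((baseAct𝒢 a).hom.edgeMap e))
    (hopen𝒢 : ∃ U : Subgroup 𝔊.PA, IsOpen (U : Set 𝔊.PA) ∧ ∀ a ∈ U,
      (∀ v, (baseAct𝒢 a).hom.vertexMap v = v) ∧ (∀ e, (baseAct𝒢 a).hom.edgeMap e = e) ∧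
        ∀ b, (baseAct𝒢 a).hom.branchMap b = b)
    (hBR𝒢 : ∀ (a : 𝔊.PA) (b : 𝒢.graph.Branch) (v : 𝒢.graph.Vertex) (hb : 𝒢.graph.abuts b = some v)
      (φ : 𝒢.Gv v →ₜ* (D𝒢.chart h39𝒢.toProp36Hypotheses.isCountable hcof𝒢 h39𝒢.toProp36Hypotheses.isConnected hS𝒢 hfin𝒢 hne𝒢).G), IsVerticialHom (D𝒢.chart h39𝒢.toProp36Hypotheses.isCountable hcof𝒢 h39𝒢.toProp36Hypotheses.isConnected hS𝒢 hfin𝒢 hne𝒢) v φ →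
      ∃ Φ : contMulAut (D𝒢.chart h39𝒢.toProp36Hypotheses.isCountable hcof𝒢 h39𝒢.toProp36Hypotheses.isConnected hS𝒢 hfin𝒢 hne𝒢).G, TopOut.mk _ Φ = ρ𝒢 a ∧
        ∃ φ' : 𝒢.Gv ((baseAct𝒢 a).hom.vertexMap v) →ₜ* (D𝒢.chart h39𝒢.toProp36Hypotheses.isCountable hcof𝒢 h39𝒢.toProp36Hypotheses.isConnected hS𝒢 hfin𝒢 hne𝒢).G,
          IsVerticialHom (D𝒢.chart h39𝒢.toProp36Hypotheses.isCountable hcof𝒢 h39𝒢.toProp36Hypotheses.isConnected hS𝒢 hfin𝒢 hne𝒢) ((baseAct𝒢 a).hom.vertexMap v) φ' ∧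
          ∃ x' : (D𝒢.chart h39𝒢.toProp36Hypotheses.isCountable hcof𝒢 h39𝒢.toProp36Hypotheses.isConnected hS𝒢 hfin𝒢 hne𝒢).G,
            Subgroup.map (Φ : MulAut (D𝒢.chart h39𝒢.toProp36Hypotheses.isCountable hcof𝒢 h39𝒢.toProp36Hypotheses.isConnected hS𝒢 hfin𝒢 hne𝒢).G).toMonoidHom φ.toMonoidHom.range =
              Subgroup.map (MulAut.conj x').toMonoidHom φ'.toMonoidHom.range ∧
            Subgroup.map (Φ : MulAut (D𝒢.chart h39𝒢.toProp36Hypotheses.isCountable hcof𝒢 h39𝒢.toProp36Hypotheses.isConnected hS𝒢 hfin𝒢 hne𝒢).G).toMonoidHom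
                (Subgroup.map φ.toMonoidHom (𝒢.branchSubgroup b v hb)) =
              Subgroup.map (MulAut.conj x').toMonoidHom
                (Subgroup.map φ'.toMonoidHom
                  (𝒢.branchSubgroup ((baseAct𝒢 a).hom.branchMap b) ((baseAct𝒢 a).hom.vertexMap v)
                    ((baseAct𝒢 a).hom.abuts_branchMap b v hb))))
    (w𝒢 : 𝒢.graph.Vertex)
    -- CHARACTERISTIC finite levels (abc-iut-L3-t9 E1): `ker π_n` is the characteristic open core of level `d𝒢 n`
    (d𝒢 : ℕ → ℕ) (hker𝒢 : ∀ n, (D𝒢.piLevelAut h39𝒢.toProp36Hypotheses.isCountable hconn𝒢 n).ker = charOpenCore (D𝒢.temperedPi h39𝒢.toProp36Hypotheses.isCountable) (d𝒢 n))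
    -- (I0v) for the tower `D𝒢`: every `𝒢_v` acts faithfully on the `v`-fibres of the levels (abc-iut-w4-d053's
    -- `faithfulV_ofOpenNormalSeq` at the prescribed open-normal / characteristic tower)
    (hfaithV𝒢 : ∀ (v : 𝒢.graph.Vertex) (h : 𝒢.Gv v),
      (∀ (n : ℕ) (x : ((D𝒢.S n).SV v).obj.V), ((D𝒢.S n).SV v).obj.ρ h x = x) → h = 1)
    -- `hK1′` REPLACED (the L3 lead's α92 wording): congruence-continuity of `ρ` at the deep tree levels with trivial
    -- base action nearby (`hCC`, Def 5.1 (i)(c)/(d) + Prop 5.2 (i)) and self-normalising vertex-group images there (`hself`)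
    (n𝒢 : ℕ)
    (hself𝒢 : ∀ n, n𝒢 ≤ n → ∀ (w : 𝒢.graph.Vertex)
      (q : (D𝒢.chart h39𝒢.toProp36Hypotheses.isCountable hcof𝒢 h39𝒢.toProp36Hypotheses.isConnected hS𝒢 hfin𝒢 hne𝒢).G ⧸ (D𝒢.projAut h39𝒢.toProp36Hypotheses.isCountable n).ker),
      (∀ x : (D𝒢.chart h39𝒢.toProp36Hypotheses.isCountable hcof𝒢 h39𝒢.toProp36Hypotheses.isConnected hS𝒢 hfin𝒢 hne𝒢).G ⧸ (D𝒢.projAut h39𝒢.toProp36Hypotheses.isCountable n).ker,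
        x ∈ ((D𝒢.piPresentation h39𝒢.toProp36Hypotheses.isCountable T𝒢 R𝒢).H w).map (QuotientGroup.mk' _) ↔
        q⁻¹ * x * q ∈ ((D𝒢.piPresentation h39𝒢.toProp36Hypotheses.isCountable T𝒢 R𝒢).H w).map (QuotientGroup.mk' _)) →
      q ∈ ((D𝒢.piPresentation h39𝒢.toProp36Hypotheses.isCountable T𝒢 R𝒢).H w).map (QuotientGroup.mk' _))
    (hCC𝒢 : ∀ n, n𝒢 ≤ n → ∃ U ∈ 𝓝 (1 : ↥𝔊.PA), ∀ a ∈ U, baseAct𝒢 a = 1 ∧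
      ∃ φ : contMulAut (D𝒢.chart h39𝒢.toProp36Hypotheses.isCountable hcof𝒢 h39𝒢.toProp36Hypotheses.isConnected hS𝒢 hfin𝒢 hne𝒢).G, TopOut.mk (D𝒢.chart h39𝒢.toProp36Hypotheses.isCountable hcof𝒢 h39𝒢.toProp36Hypotheses.isConnected hS𝒢 hfin𝒢 hne𝒢).G φ = ρ𝒢 a ∧
        ∀ y : (D𝒢.chart h39𝒢.toProp36Hypotheses.isCountable hcof𝒢 h39𝒢.toProp36Hypotheses.isConnected hS𝒢 hfin𝒢 hne𝒢).G, (φ : MulAut (D𝒢.chart h39𝒢.toProp36Hypotheses.isCountable hcof𝒢 h39𝒢.toProp36Hypotheses.isConnected hS𝒢 hfin𝒢 hne𝒢).G) y * y⁻¹ ∈ (D𝒢.projAut h39𝒢.toProp36Hypotheses.isCountable n).ker)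
    -- the topology of `E` IS abc-iut-w6-d070's tempered level topology at the chart of the tower
    (hinst𝒢 : inst𝒢 = @arithLevelTopology 𝒢 (D𝒢.chart h39𝒢.toProp36Hypotheses.isCountable hcof𝒢 h39𝒢.toProp36Hypotheses.isConnected hS𝒢 hfin𝒢 hne𝒢) 𝔊.PA _ _ _ ρ𝒢 baseAct𝒢
        (TemperedPiChart.firstCountableTopology_G (D𝒢.chart h39𝒢.toProp36Hypotheses.isCountable hcof𝒢 h39𝒢.toProp36Hypotheses.isConnected hS𝒢 hfin𝒢 hne𝒢)) h39𝒢.toProp36Hypotheses IsTempered.of_profinite (D𝒢.piPresentation h39𝒢.toProp36Hypotheses.isCountable T𝒢 R𝒢)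
        (isArithCompatible_piPresentation_outerAction_of_branchPair_chart_of_finite D𝒢 h39𝒢.toProp36Hypotheses.isCountable hcof𝒢 h39𝒢.toProp36Hypotheses.isConnected hS𝒢 hfin𝒢 hne𝒢 T𝒢 R𝒢 ρ𝒢 baseAct𝒢 h39𝒢.thm37Hypotheses h39𝒢.isGraph hV𝒢 hBR𝒢) w𝒢
        (D𝒢.isCompact_piPresentation_H h39𝒢.toProp36Hypotheses.isCountable T𝒢 R𝒢 w𝒢) (fun n => (D𝒢.projAut h39𝒢.toProp36Hypotheses.isCountable n).ker) (fun _ => MonoidHom.normal_ker _)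
        (D𝒢.hKst_and_hLst_of_ker_piLevelAut_eq_charOpenCore h39𝒢.toProp36Hypotheses.isCountable hconn𝒢 T𝒢 R𝒢 ρ𝒢 (isArithCompatible_piPresentation_outerAction_of_branchPair_chart_of_finite D𝒢 h39𝒢.toProp36Hypotheses.isCountable hcof𝒢 h39𝒢.toProp36Hypotheses.isConnected hS𝒢 hfin𝒢 hne𝒢 T𝒢 R𝒢 ρ𝒢 baseAct𝒢 h39𝒢.thm37Hypotheses h39𝒢.isGraph hV𝒢 hBR𝒢) d𝒢 hker𝒢).1
        (D𝒢.ker_projAut_anti h39𝒢.toProp36Hypotheses.isCountable) (D𝒢.isOpen_ker_projAut h39𝒢.toProp36Hypotheses.isCountable) (fun _ hU => D𝒢.exists_ker_projAut_subset h39𝒢.toProp36Hypotheses.isCountable hU)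
        (GaloisLevelData.hK1'_chart_of_eventually_congruenceContinuous_of_hself D𝒢 h39𝒢.toProp36Hypotheses.isCountable hcof𝒢 h39𝒢.toProp36Hypotheses.isConnected hS𝒢 hfin𝒢 hne𝒢 hconn𝒢 ρ𝒢 baseAct𝒢 T𝒢 R𝒢
          (isArithCompatible_piPresentation_outerAction_of_branchPair_chart_of_finite D𝒢 h39𝒢.toProp36Hypotheses.isCountable hcof𝒢 h39𝒢.toProp36Hypotheses.isConnected hS𝒢 hfin𝒢 hne𝒢 T𝒢 R𝒢 ρ𝒢 baseAct𝒢 h39𝒢.thm37Hypotheses h39𝒢.isGraph hV𝒢 hBR𝒢)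
          d𝒢 hker𝒢 h39𝒢.isGraph n𝒢 hself𝒢 hCC𝒢))
    (noSwitch𝒢 : NoBranchSwitching 𝒢.graph.edgeOf
      (fun (a : 𝔊.PA) (b : 𝒢.graph.Branch) => (baseAct𝒢 a).hom.branchMap b))
    -- (AI4″) `stabBranchPairAug` REPLACED by the inputs of abc-iut-w4-d059's hcof-FREE
    -- `stabBranchPairAug_chart_outerAction_modKernel` that are NOT terms: only the chart representatives read off the presentation
    (hRcV𝒢 : ∀ v, Rc𝒢.Hv v = (D𝒢.piPresentation h39𝒢.toProp36Hypotheses.isCountable T𝒢 R𝒢).H v)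
    (hRcB𝒢 : ∀ b, Rc𝒢.Hb b = ((D𝒢.piPresentation h39𝒢.toProp36Hypotheses.isCountable T𝒢 R𝒢).M (𝒢.graph.edgeOf b)).map
      (MulAut.conj ((D𝒢.piPresentation h39𝒢.toProp36Hypotheses.isCountable T𝒢 R𝒢).s b)).toMonoidHom)
    (hest𝒢 : IsTotallyArithEstranged (decompositionDataOfChart Rc𝒢 (toOuterSemidirectProduct ρ𝒢)) (outerSemidirectProductSnd ρ𝒢)) (hbot𝒢 : ¬ IsArithAmple (outerSemidirectProductSnd ρ𝒢) ⊥)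
    -- ── the ℍ′ side: a cofinal Galois tower with characteristic levels, its chart, the outer model over `Π_{A′}` ──
    (h39ℋ : Cor39Hypotheses ℋ) (Dℋ : GaloisLevelData ℋ)
    (hcofℋ : ∀ (X : CovObj ℋ), X.IsTempered → ∀ p : X.Point, ∃ i : ℕ, ∀ j, i ≤ j → (Dℋ.S j).Splits (X.component p))
    (hSℋ : ∀ n, (Dℋ.S n).Splits (Dℋ.S n)) (hfinℋ : ∀ n, (Dℋ.S n).IsFinite) (hneℋ : ∀ n, (Dℋ.S n).HasNonemptyFibres)
    (hconnℋ : ∀ (n : ℕ) (p q : (Dℋ.S n).Point), (Dℋ.S n).SameComponent p q)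
    [Finite ℋ.graph.Vertex] [Finite ℋ.graph.Branch]
    [Finite ℋ.graph.Edge]
    (ρℋ : ℍ.PA →* TopOut (Dℋ.chart h39ℋ.toProp36Hypotheses.isCountable hcofℋ h39ℋ.toProp36Hypotheses.isConnected hSℋ hfinℋ hneℋ).G) (baseActℋ : ℍ.PA →* Aut ℋ.graph)
    [instℋ : TopologicalSpace (outerSemidirectProduct ρℋ)]
    (Tℋ : ∀ w : ℋ.graph.Vertex, Dℋ.PointSeq h39ℋ.toProp36Hypotheses.isCountable w) (Rℋ : SemiGraph.RefBranches ℋ.graph)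
    (Rcℋ : ChartRepresentatives (Dℋ.chart h39ℋ.toProp36Hypotheses.isCountable hcofℋ h39ℋ.toProp36Hypotheses.isConnected hSℋ hfinℋ hneℋ))
    -- Prop 3.6 (iv) at `ρ_𝔾(a)` / Def 5.1 (i)(c): the DESIGN data of the outer model (abc-iut-w4-d082's currency)
    (hVℋ : ∀ (a : ℍ.PA) (v : ℋ.graph.Vertex) (H : Subgroup (Dℋ.chart h39ℋ.toProp36Hypotheses.isCountable hcofℋ h39ℋ.toProp36Hypotheses.isConnected hSℋ hfinℋ hneℋ).G), H ∈ verticialSubgroups (Dℋ.chart h39ℋ.toProp36Hypotheses.isCountable hcofℋ h39ℋ.toProp36Hypotheses.isConnected hSℋ hfinℋ hneℋ) v →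
      ∃ φ : contMulAut (Dℋ.chart h39ℋ.toProp36Hypotheses.isCountable hcofℋ h39ℋ.toProp36Hypotheses.isConnected hSℋ hfinℋ hneℋ).G, TopOut.mk _ φ = ρℋ a ∧
        H.map (φ : MulAut (Dℋ.chart h39ℋ.toProp36Hypotheses.isCountable hcofℋ h39ℋ.toProp36Hypotheses.isConnected hSℋ hfinℋ hneℋ).G).toMonoidHom ∈ verticialSubgroups (Dℋ.chart h39ℋ.toProp36Hypotheses.isCountable hcofℋ h39ℋ.toProp36Hypotheses.isConnected hSℋ hfinℋ hneℋ) ((baseActℋ a).hom.vertexMap v))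
    (hEℋ : ∀ (a : ℍ.PA) (e : ℋ.graph.Edge) (K : Subgroup (Dℋ.chart h39ℋ.toProp36Hypotheses.isCountable hcofℋ h39ℋ.toProp36Hypotheses.isConnected hSℋ hfinℋ hneℋ).G), K ∈ edgeLikeSubgroups (Dℋ.chart h39ℋ.toProp36Hypotheses.isCountable hcofℋ h39ℋ.toProp36Hypotheses.isConnected hSℋ hfinℋ hneℋ) e →
      ∃ φ : contMulAut (Dℋ.chart h39ℋ.toProp36Hypotheses.isCountable hcofℋ h39ℋ.toProp36Hypotheses.isConnected hSℋ hfinℋ hneℋ).G, TopOut.mk _ φ = ρℋ a ∧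
        K.map (φ : MulAut (Dℋ.chart h39ℋ.toProp36Hypotheses.isCountable hcofℋ h39ℋ.toProp36Hypotheses.isConnected hSℋ hfinℋ hneℋ).G).toMonoidHom ∈ edgeLikeSubgroups (Dℋ.chart h39ℋ.toProp36Hypotheses.isCountable hcofℋ h39ℋ.toProp36Hypotheses.isConnected hSℋ hfinℋ hneℋ) ((baseActℋ a).hom.edgeMap e))
    (hopenℋ : ∃ U : Subgroup ℍ.PA, IsOpen (U : Set ℍ.PA) ∧ ∀ a ∈ U,
      (∀ v, (baseActℋ a).hom.vertexMap v = v) ∧ (∀ e, (baseActℋ a).hom.edgeMap e = e) ∧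
        ∀ b, (baseActℋ a).hom.branchMap b = b)
    (hBRℋ : ∀ (a : ℍ.PA) (b : ℋ.graph.Branch) (v : ℋ.graph.Vertex) (hb : ℋ.graph.abuts b = some v)
      (φ : ℋ.Gv v →ₜ* (Dℋ.chart h39ℋ.toProp36Hypotheses.isCountable hcofℋ h39ℋ.toProp36Hypotheses.isConnected hSℋ hfinℋ hneℋ).G), IsVerticialHom (Dℋ.chart h39ℋ.toProp36Hypotheses.isCountable hcofℋ h39ℋ.toProp36Hypotheses.isConnected hSℋ hfinℋ hneℋ) v φ →
      ∃ Φ : contMulAut (Dℋ.chart h39ℋ.toProp36Hypotheses.isCountable hcofℋ h39ℋ.toProp36Hypotheses.isConnected hSℋ hfinℋ hneℋ).G, TopOut.mk _ Φ = ρℋ a ∧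
        ∃ φ' : ℋ.Gv ((baseActℋ a).hom.vertexMap v) →ₜ* (Dℋ.chart h39ℋ.toProp36Hypotheses.isCountable hcofℋ h39ℋ.toProp36Hypotheses.isConnected hSℋ hfinℋ hneℋ).G,
          IsVerticialHom (Dℋ.chart h39ℋ.toProp36Hypotheses.isCountable hcofℋ h39ℋ.toProp36Hypotheses.isConnected hSℋ hfinℋ hneℋ) ((baseActℋ a).hom.vertexMap v) φ' ∧
          ∃ x' : (Dℋ.chart h39ℋ.toProp36Hypotheses.isCountable hcofℋ h39ℋ.toProp36Hypotheses.isConnected hSℋ hfinℋ hneℋ).G,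
            Subgroup.map (Φ : MulAut (Dℋ.chart h39ℋ.toProp36Hypotheses.isCountable hcofℋ h39ℋ.toProp36Hypotheses.isConnected hSℋ hfinℋ hneℋ).G).toMonoidHom φ.toMonoidHom.range =
              Subgroup.map (MulAut.conj x').toMonoidHom φ'.toMonoidHom.range ∧
            Subgroup.map (Φ : MulAut (Dℋ.chart h39ℋ.toProp36Hypotheses.isCountable hcofℋ h39ℋ.toProp36Hypotheses.isConnected hSℋ hfinℋ hneℋ).G).toMonoidHom
                (Subgroup.map φ.toMonoidHom (ℋ.branchSubgroup b v hb)) =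
              Subgroup.map (MulAut.conj x').toMonoidHom
                (Subgroup.map φ'.toMonoidHom
                  (ℋ.branchSubgroup ((baseActℋ a).hom.branchMap b) ((baseActℋ a).hom.vertexMap v)
                    ((baseActℋ a).hom.abuts_branchMap b v hb))))
    (wℋ : ℋ.graph.Vertex)
    -- CHARACTERISTIC finite levels (abc-iut-L3-t9 E1): `ker π_n` is the characteristic open core of level `dℋ n`
    (dℋ : ℕ → ℕ) (hkerℋ : ∀ n, (Dℋ.piLevelAut h39ℋ.toProp36Hypotheses.isCountable hconnℋ n).ker = charOpenCore (Dℋ.temperedPi h39ℋ.toProp36Hypotheses.isCountable) (dℋ n))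
    -- (I0v) for the tower `Dℋ`: every `ℋ_v` acts faithfully on the `v`-fibres of the levels (abc-iut-w4-d053's
    -- `faithfulV_ofOpenNormalSeq` at the prescribed open-normal / characteristic tower)
    (hfaithVℋ : ∀ (v : ℋ.graph.Vertex) (h : ℋ.Gv v),
      (∀ (n : ℕ) (x : ((Dℋ.S n).SV v).obj.V), ((Dℋ.S n).SV v).obj.ρ h x = x) → h = 1)
    -- `hK1′` REPLACED (the L3 lead's α92 wording): congruence-continuity of `ρ` at the deep tree levels with trivial
    -- base action nearby (`hCC`, Def 5.1 (i)(c)/(d) + Prop 5.2 (i)) and self-normalising vertex-group images there (`hself`)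
    (nℋ : ℕ)
    (hselfℋ : ∀ n, nℋ ≤ n → ∀ (w : ℋ.graph.Vertex)
      (q : (Dℋ.chart h39ℋ.toProp36Hypotheses.isCountable hcofℋ h39ℋ.toProp36Hypotheses.isConnected hSℋ hfinℋ hneℋ).G ⧸ (Dℋ.projAut h39ℋ.toProp36Hypotheses.isCountable n).ker),
      (∀ x : (Dℋ.chart h39ℋ.toProp36Hypotheses.isCountable hcofℋ h39ℋ.toProp36Hypotheses.isConnected hSℋ hfinℋ hneℋ).G ⧸ (Dℋ.projAut h39ℋ.toProp36Hypotheses.isCountable n).ker,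
        x ∈ ((Dℋ.piPresentation h39ℋ.toProp36Hypotheses.isCountable Tℋ Rℋ).H w).map (QuotientGroup.mk' _) ↔
        q⁻¹ * x * q ∈ ((Dℋ.piPresentation h39ℋ.toProp36Hypotheses.isCountable Tℋ Rℋ).H w).map (QuotientGroup.mk' _)) →
      q ∈ ((Dℋ.piPresentation h39ℋ.toProp36Hypotheses.isCountable Tℋ Rℋ).H w).map (QuotientGroup.mk' _))
    (hCCℋ : ∀ n, nℋ ≤ n → ∃ U ∈ 𝓝 (1 : ↥ℍ.PA), ∀ a ∈ U, baseActℋ a = 1 ∧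
      ∃ φ : contMulAut (Dℋ.chart h39ℋ.toProp36Hypotheses.isCountable hcofℋ h39ℋ.toProp36Hypotheses.isConnected hSℋ hfinℋ hneℋ).G, TopOut.mk (Dℋ.chart h39ℋ.toProp36Hypotheses.isCountable hcofℋ h39ℋ.toProp36Hypotheses.isConnected hSℋ hfinℋ hneℋ).G φ = ρℋ a ∧
        ∀ y : (Dℋ.chart h39ℋ.toProp36Hypotheses.isCountable hcofℋ h39ℋ.toProp36Hypotheses.isConnected hSℋ hfinℋ hneℋ).G, (φ : MulAut (Dℋ.chart h39ℋ.toProp36Hypotheses.isCountable hcofℋ h39ℋ.toProp36Hypotheses.isConnected hSℋ hfinℋ hneℋ).G) y * y⁻¹ ∈ (Dℋ.projAut h39ℋ.toProp36Hypotheses.isCountable n).ker)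
    -- the topology of `E` IS abc-iut-w6-d070's tempered level topology at the chart of the tower
    (hinstℋ : instℋ = @arithLevelTopology ℋ (Dℋ.chart h39ℋ.toProp36Hypotheses.isCountable hcofℋ h39ℋ.toProp36Hypotheses.isConnected hSℋ hfinℋ hneℋ) ℍ.PA _ _ _ ρℋ baseActℋ
        (TemperedPiChart.firstCountableTopology_G (Dℋ.chart h39ℋ.toProp36Hypotheses.isCountable hcofℋ h39ℋ.toProp36Hypotheses.isConnected hSℋ hfinℋ hneℋ)) h39ℋ.toProp36Hypotheses IsTempered.of_profinite (Dℋ.piPresentation h39ℋ.toProp36Hypotheses.isCountable Tℋ Rℋ)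
        (isArithCompatible_piPresentation_outerAction_of_branchPair_chart_of_finite Dℋ h39ℋ.toProp36Hypotheses.isCountable hcofℋ h39ℋ.toProp36Hypotheses.isConnected hSℋ hfinℋ hneℋ Tℋ Rℋ ρℋ baseActℋ h39ℋ.thm37Hypotheses h39ℋ.isGraph hVℋ hBRℋ) wℋ
        (Dℋ.isCompact_piPresentation_H h39ℋ.toProp36Hypotheses.isCountable Tℋ Rℋ wℋ) (fun n => (Dℋ.projAut h39ℋ.toProp36Hypotheses.isCountable n).ker) (fun _ => MonoidHom.normal_ker _)
        (Dℋ.hKst_and_hLst_of_ker_piLevelAut_eq_charOpenCore h39ℋ.toProp36Hypotheses.isCountable hconnℋ Tℋ Rℋ ρℋ (isArithCompatible_piPresentation_outerAction_of_branchPair_chart_of_finite Dℋ h39ℋ.toProp36Hypotheses.isCountable hcofℋ h39ℋ.toProp36Hypotheses.isConnected hSℋ hfinℋ hneℋ Tℋ Rℋ ρℋ baseActℋ h39ℋ.thm37Hypotheses h39ℋ.isGraph hVℋ hBRℋ) dℋ hkerℋ).1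
        (Dℋ.ker_projAut_anti h39ℋ.toProp36Hypotheses.isCountable) (Dℋ.isOpen_ker_projAut h39ℋ.toProp36Hypotheses.isCountable) (fun _ hU => Dℋ.exists_ker_projAut_subset h39ℋ.toProp36Hypotheses.isCountable hU)
        (GaloisLevelData.hK1'_chart_of_eventually_congruenceContinuous_of_hself Dℋ h39ℋ.toProp36Hypotheses.isCountable hcofℋ h39ℋ.toProp36Hypotheses.isConnected hSℋ hfinℋ hneℋ hconnℋ ρℋ baseActℋ Tℋ Rℋ
          (isArithCompatible_piPresentation_outerAction_of_branchPair_chart_of_finite Dℋ h39ℋ.toProp36Hypotheses.isCountable hcofℋ h39ℋ.toProp36Hypotheses.isConnected hSℋ hfinℋ hneℋ Tℋ Rℋ ρℋ baseActℋ h39ℋ.thm37Hypotheses h39ℋ.isGraph hVℋ hBRℋ)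
          dℋ hkerℋ h39ℋ.isGraph nℋ hselfℋ hCCℋ))
    (noSwitchℋ : NoBranchSwitching ℋ.graph.edgeOf
      (fun (a : ℍ.PA) (b : ℋ.graph.Branch) => (baseActℋ a).hom.branchMap b))
    -- (AI4″) `stabBranchPairAug` REPLACED by the inputs of abc-iut-w4-d059's hcof-FREE
    -- `stabBranchPairAug_chart_outerAction_modKernel` that are NOT terms: only the chart representatives read off the presentation
    (hRcVℋ : ∀ v, Rcℋ.Hv v = (Dℋ.piPresentation h39ℋ.toProp36Hypotheses.isCountable Tℋ Rℋ).H v)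
    (hRcBℋ : ∀ b, Rcℋ.Hb b = ((Dℋ.piPresentation h39ℋ.toProp36Hypotheses.isCountable Tℋ Rℋ).M (ℋ.graph.edgeOf b)).map
      (MulAut.conj ((Dℋ.piPresentation h39ℋ.toProp36Hypotheses.isCountable Tℋ Rℋ).s b)).toMonoidHom)
    (hestℋ : IsTotallyArithEstranged (decompositionDataOfChart Rcℋ (toOuterSemidirectProduct ρℋ)) (outerSemidirectProductSnd ρℋ)) (hbotℋ : ¬ IsArithAmple (outerSemidirectProductSnd ρℋ) ⊥)
    -- ── Thm 5.4 (iii): the arithmetic `B^temp`, the dictionary, the represented graph actions (design) ──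
    -- the arithmetic `B^temp` (design binder of the umbrella)
    (btemp : (φ : ArithHom 𝓥 𝔊 ℍ) → φ.IsLocallyOpen → ArithHom.IsOverA 𝔊 ℍ e φ →
      (outerSemidirectProduct ρ𝒢 →* outerSemidirectProduct ρℋ))
    (hcont : ∀ (φ : ArithHom 𝓥 𝔊 ℍ) (h₁ : φ.IsLocallyOpen) (h₂ : ArithHom.IsOverA 𝔊 ℍ e φ),
      Continuous (btemp φ h₁ h₂))
    (hover : ∀ (φ : ArithHom 𝓥 𝔊 ℍ) (h₁ : φ.IsLocallyOpen) (h₂ : ArithHom.IsOverA 𝔊 ℍ e φ),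
      (e.symm.toMonoidHom.comp (outerSemidirectProductSnd ρℋ)).comp (btemp φ h₁ h₂) = outerSemidirectProductSnd ρ𝒢)
    -- (D1)/(D2): the dictionary of arrows with chosen 2-cells and its chart-level representatives (verbatim)
    (dict : (𝔊.G ⟶ ℍ.G) → Hom 𝒢 ℋ) (θd : ∀ g, (dict g).ConjugatorFamily) (hlo : ∀ g, (dict g).IsLocallyOpen)
    (φc : (𝔊.G ⟶ ℍ.G) → ((D𝒢.chart h39𝒢.toProp36Hypotheses.isCountable hcof𝒢 h39𝒢.toProp36Hypotheses.isConnected hS𝒢 hfin𝒢 hne𝒢).G →ₜ* (Dℋ.chart h39ℋ.toProp36Hypotheses.isCountable hcofℋ h39ℋ.toProp36Hypotheses.isConnected hSℋ hfinℋ hneℋ).G))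
    (hφc : ∀ g, Nonempty ((dict g).chartPullbackWith (θd g) (D𝒢.chart h39𝒢.toProp36Hypotheses.isCountable hcof𝒢 h39𝒢.toProp36Hypotheses.isConnected hS𝒢 hfin𝒢 hne𝒢) (Dℋ.chart h39ℋ.toProp36Hypotheses.isCountable hcofℋ h39ℋ.toProp36Hypotheses.isConnected hSℋ hfinℋ hneℋ) ≅ BTemp.res (φc g)))
    (hfaith : ∀ g₁ g₂ : 𝔊.G ⟶ ℍ.G, Nonempty ((dict g₁).chartPullbackWith (θd g₁) (D𝒢.chart h39𝒢.toProp36Hypotheses.isCountable hcof𝒢 h39𝒢.toProp36Hypotheses.isConnected hS𝒢 hfin𝒢 hne𝒢) (Dℋ.chart h39ℋ.toProp36Hypotheses.isCountable hcofℋ h39ℋ.toProp36Hypotheses.isConnected hSℋ hfinℋ hneℋ) ≅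
      (dict g₂).chartPullbackWith (θd g₂) (D𝒢.chart h39𝒢.toProp36Hypotheses.isCountable hcof𝒢 h39𝒢.toProp36Hypotheses.isConnected hS𝒢 hfin𝒢 hne𝒢) (Dℋ.chart h39ℋ.toProp36Hypotheses.isCountable hcofℋ h39ℋ.toProp36Hypotheses.isConnected hSℋ hfinℋ hneℋ)) → g₁ = g₂)
    (hfull : ∀ F : Hom 𝒢 ℋ, F.IsLocallyOpen → ∀ θ : F.ConjugatorFamily,
      ∃ g : 𝔊.G ⟶ ℍ.G, Nonempty ((dict g).chartPullbackWith (θd g) (D𝒢.chart h39𝒢.toProp36Hypotheses.isCountable hcof𝒢 h39𝒢.toProp36Hypotheses.isConnected hS𝒢 hfin𝒢 hne𝒢) (Dℋ.chart h39ℋ.toProp36Hypotheses.isCountable hcofℋ h39ℋ.toProp36Hypotheses.isConnected hSℋ hfinℋ hneℋ) ≅ F.chartPullbackWith θ (D𝒢.chart h39𝒢.toProp36Hypotheses.isCountable hcof𝒢 h39𝒢.toProp36Hypotheses.isConnected hS𝒢 hfin𝒢 hne𝒢) (Dℋ.chart h39ℋ.toProp36Hypotheses.isCountable hcofℋ h39ℋ.toProp36Hypotheses.isConnected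 hSℋ hfinℋ hneℋ)))
    -- (D1a)/(D1b): the graph actions of `Π_A` on `𝔾` and of `Π_{A′}` on `ℍ′` with chosen 2-cells, REPRESENTED at
    -- the outer actions (abc-iut-w5-d141's `hrep` currency), and the functoriality of the dictionary
    (F𝒢 : 𝔊.PA → Hom 𝒢 𝒢) (θ𝒢 : ∀ a, (F𝒢 a).ConjugatorFamily)
    (hrep𝒢 : ∀ a, ∃ (Φ : contMulAut (D𝒢.chart h39𝒢.toProp36Hypotheses.isCountable hcof𝒢 h39𝒢.toProp36Hypotheses.isConnected hS𝒢 hfin𝒢 hne𝒢).G) (φ : (D𝒢.chart h39𝒢.toProp36Hypotheses.isCountable hcof𝒢 h39𝒢.toProp36Hypotheses.isConnected hS𝒢 hfin𝒢 hne𝒢).G →ₜ* (D𝒢.chart h39𝒢.toProp36Hypotheses.isCountable hcof𝒢 h39𝒢.toProp36Hypotheses.isConnected hS𝒢 hfin𝒢 hne𝒢).G), TopOut.mk (D𝒢.chart h39𝒢.toProp36Hypotheses.isCountable hcof𝒢 h39𝒢.toProp36Hypotheses.isConnected hS𝒢 hfin𝒢 hne𝒢).G Φ = ρ𝒢 a 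∧
      (∀ t, (Φ : MulAut (D𝒢.chart h39𝒢.toProp36Hypotheses.isCountable hcof𝒢 h39𝒢.toProp36Hypotheses.isConnected hS𝒢 hfin𝒢 hne𝒢).G) t = φ t) ∧ Nonempty ((F𝒢 a).chartPullbackWith (θ𝒢 a) (D𝒢.chart h39𝒢.toProp36Hypotheses.isCountable hcof𝒢 h39𝒢.toProp36Hypotheses.isConnected hS𝒢 hfin𝒢 hne𝒢) (D𝒢.chart h39𝒢.toProp36Hypotheses.isCountable hcof𝒢 h39𝒢.toProp36Hypotheses.isConnected hS𝒢 hfin𝒢 hne𝒢) ≅ BTemp.res φ))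
    (hpre : ∀ (a : 𝔊.PA) (g : 𝔊.G ⟶ ℍ.G),
      Nonempty ((dict ((𝔊.ρ a).hom ≫ g)).chartPullbackWith (θd ((𝔊.ρ a).hom ≫ g)) (D𝒢.chart h39𝒢.toProp36Hypotheses.isCountable hcof𝒢 h39𝒢.toProp36Hypotheses.isConnected hS𝒢 hfin𝒢 hne𝒢) (Dℋ.chart h39ℋ.toProp36Hypotheses.isCountable hcofℋ h39ℋ.toProp36Hypotheses.isConnected hSℋ hfinℋ hneℋ) ≅
        (dict g).chartPullbackWith (θd g) (D𝒢.chart h39𝒢.toProp36Hypotheses.isCountable hcof𝒢 h39𝒢.toProp36Hypotheses.isConnected hS𝒢 hfin𝒢 hne𝒢) (Dℋ.chart h39ℋ.toProp36Hypotheses.isCountable hcofℋ h39ℋ.toProp36Hypotheses.isConnected hSℋ hfinℋ hneℋ) ⋙ (F𝒢 a).chartPullbackWith (θ𝒢 a) (D𝒢.chart h39𝒢.toProp36Hypotheses.isCountable hcof𝒢 h39𝒢.toProp36Hypotheses.isConnected hS𝒢 hfin𝒢 hne𝒢) (D𝒢.chart h39𝒢.toProp36Hypotheses.isCountable hcof𝒢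 h39𝒢.toProp36Hypotheses.isConnected hS𝒢 hfin𝒢 hne𝒢)))
    (Fℋ : ℍ.PA → Hom ℋ ℋ) (θℋ : ∀ a, (Fℋ a).ConjugatorFamily)
    (hrepℋ : ∀ a, ∃ (Φ : contMulAut (Dℋ.chart h39ℋ.toProp36Hypotheses.isCountable hcofℋ h39ℋ.toProp36Hypotheses.isConnected hSℋ hfinℋ hneℋ).G) (φ : (Dℋ.chart h39ℋ.toProp36Hypotheses.isCountable hcofℋ h39ℋ.toProp36Hypotheses.isConnected hSℋ hfinℋ hneℋ).G →ₜ* (Dℋ.chart h39ℋ.toProp36Hypotheses.isCountable hcofℋ h39ℋ.toProp36Hypotheses.isConnected hSℋ hfinℋ hneℋ).G), TopOut.mk (Dℋ.chart h39ℋ.toProp36Hypotheses.isCountable hcofℋ h39ℋ.toProp36Hypotheses.isConnected hSℋ hfinℋ hneℋ).G Φ = ρℋ a ∧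
      (∀ t, (Φ : MulAut (Dℋ.chart h39ℋ.toProp36Hypotheses.isCountable hcofℋ h39ℋ.toProp36Hypotheses.isConnected hSℋ hfinℋ hneℋ).G) t = φ t) ∧ Nonempty ((Fℋ a).chartPullbackWith (θℋ a) (Dℋ.chart h39ℋ.toProp36Hypotheses.isCountable hcofℋ h39ℋ.toProp36Hypotheses.isConnected hSℋ hfinℋ hneℋ) (Dℋ.chart h39ℋ.toProp36Hypotheses.isCountable hcofℋ h39ℋ.toProp36Hypotheses.isConnected hSℋ hfinℋ hneℋ) ≅ BTemp.res φ))
    (hpost : ∀ (a : ℍ.PA) (g : 𝔊.G ⟶ ℍ.G),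
      Nonempty ((dict (g ≫ (ℍ.ρ a).hom)).chartPullbackWith (θd (g ≫ (ℍ.ρ a).hom)) (D𝒢.chart h39𝒢.toProp36Hypotheses.isCountable hcof𝒢 h39𝒢.toProp36Hypotheses.isConnected hS𝒢 hfin𝒢 hne𝒢) (Dℋ.chart h39ℋ.toProp36Hypotheses.isCountable hcofℋ h39ℋ.toProp36Hypotheses.isConnected hSℋ hfinℋ hneℋ) ≅
        (Fℋ a).chartPullbackWith (θℋ a) (Dℋ.chart h39ℋ.toProp36Hypotheses.isCountable hcofℋ h39ℋ.toProp36Hypotheses.isConnected hSℋ hfinℋ hneℋ) (Dℋ.chart h39ℋ.toProp36Hypotheses.isCountable hcofℋ h39ℋ.toProp36Hypotheses.isConnected hSℋ hfinℋ hneℋ) ⋙ (dict g).chartPullbackWith (θd g) (D𝒢.chart h39𝒢.toProp36Hypotheses.isCountable hcof𝒢 h39𝒢.toProp36Hypotheses.isConnected hS𝒢 hfin𝒢 hne𝒢) (Dℋ.chart h39ℋ.toProp36Hypotheses.isCountable hcofℋ h39ℋ.toProp36Hypotheses.isConnected hSℋ hfinℋ hneℋ)))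
    -- the arithmetic `B^temp` on the geometric part, chart currency (verbatim, kernel of `aug_ℍ` natively)
    (hbtempφ : ∀ (φ : ArithHom 𝓥 𝔊 ℍ) (h₁ : φ.IsLocallyOpen) (h₂ : ArithHom.IsOverA 𝔊 ℍ e φ),
      ∃ δ ∈ (outerSemidirectProductSnd ρℋ).ker,
        ∀ y : (D𝒢.chart h39𝒢.toProp36Hypotheses.isCountable hcof𝒢 h39𝒢.toProp36Hypotheses.isConnected hS𝒢 hfin𝒢 hne𝒢).G, btemp φ h₁ h₂ (toOuterSemidirectProduct ρ𝒢 y) =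
          δ * toOuterSemidirectProduct ρℋ (φc φ.geom y) * δ⁻¹)
    (he : Continuous e) :
    (ArithMaximalCompactStatementI (decompositionDataOfChart Rc𝒢 (toOuterSemidirectProduct ρ𝒢)) (outerSemidirectProductSnd ρ𝒢) ∧
      ArithMaximalCompactStatementII (decompositionDataOfChart Rc𝒢 (toOuterSemidirectProduct ρ𝒢)) (outerSemidirectProductSnd ρ𝒢)) ∧
    (ArithMaximalCompactStatementI (decompositionDataOfChart Rcℋ (toOuterSemidirectProduct ρℋ)) (outerSemidirectProductSnd ρℋ) ∧
      ArithMaximalCompactStatementII (decompositionDataOfChart Rcℋ (toOuterSemidirectProduct ρℋ)) (outerSemidirectProductSnd ρℋ)) ∧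
    Literature.AnabelianGeometry.SemiGraphs.ArithQuasiGeometricCorrespondenceStatementCompat 𝔊 ℍ e
      (outerSemidirectProductSnd ρ𝒢) (outerSemidirectProductSnd ρℋ) btemp := by
  -- `σ ∘ ι = 1` at both outer models (exactness, temp-slimness)
  have hισ𝒢 : ∀ g : (D𝒢.chart h39𝒢.toProp36Hypotheses.isCountable hcof𝒢 h39𝒢.toProp36Hypotheses.isConnected hS𝒢 hfin𝒢 hne𝒢).G, (baseAct𝒢.comp (outerSemidirectProductSnd ρ𝒢)) ((toOuterSemidirectProduct ρ𝒢) g) = 1 :=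
    fun g => by
      obtain ⟨-, hex, -⟩ := outerAction_exact (D𝒢.chart h39𝒢.toProp36Hypotheses.isCountable hcof𝒢 h39𝒢.toProp36Hypotheses.isConnected hS𝒢 hfin𝒢 hne𝒢) ρ𝒢 h39𝒢.toProp36Hypotheses
      have hg : (toOuterSemidirectProduct ρ𝒢) g ∈ (outerSemidirectProductSnd ρ𝒢).ker := hex ▸ ⟨g, rfl⟩
      rw [MonoidHom.comp_apply, (MonoidHom.mem_ker).mp hg, map_one]
  have hισℋ : ∀ g : (Dℋ.chart h39ℋ.toProp36Hypotheses.isCountable hcofℋ h39ℋ.toProp36Hypotheses.isConnected hSℋ hfinℋ hneℋ).G, (baseActℋ.comp (outerSemidirectProductSnd ρℋ)) ((toOuterSemidirectProduct ρℋ) g) = 1 :=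
    fun g => by
      obtain ⟨-, hex, -⟩ := outerAction_exact (Dℋ.chart h39ℋ.toProp36Hypotheses.isCountable hcofℋ h39ℋ.toProp36Hypotheses.isConnected hSℋ hfinℋ hneℋ) ρℋ h39ℋ.toProp36Hypotheses
      have hg : (toOuterSemidirectProduct ρℋ) g ∈ (outerSemidirectProductSnd ρℋ).ker := hex ▸ ⟨g, rfl⟩
      rw [MonoidHom.comp_apply, (MonoidHom.mem_ker).mp hg, map_one]
  -- the two topology pins
  subst hinst𝒢 hinstℋ
  have hP𝒢' := isArithCompatible_piPresentation_outerAction_of_branchPair_chart_of_finite D𝒢 h39𝒢.toProp36Hypotheses.isCountable hcof𝒢 h39𝒢.toProp36Hypotheses.isConnected hS𝒢 hfin𝒢 hne𝒢 T𝒢 R𝒢 ρ𝒢 baseAct𝒢 h39𝒢.thm37Hypotheses h39𝒢.isGraph hV𝒢 hBR𝒢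
  have hKL𝒢' := D𝒢.hKst_and_hLst_of_ker_piLevelAut_eq_charOpenCore h39𝒢.toProp36Hypotheses.isCountable hconn𝒢 T𝒢 R𝒢 ρ𝒢 hP𝒢' d𝒢 hker𝒢
  have hK1𝒢' := GaloisLevelData.hK1'_chart_of_eventually_congruenceContinuous_of_hself D𝒢 h39𝒢.toProp36Hypotheses.isCountable hcof𝒢 h39𝒢.toProp36Hypotheses.isConnected hS𝒢 hfin𝒢 hne𝒢 hconn𝒢 ρ𝒢 baseAct𝒢 T𝒢 R𝒢
    hP𝒢' d𝒢 hker𝒢 h39𝒢.isGraph n𝒢 hself𝒢 hCC𝒢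
  have hcpt𝒢' := D𝒢.isCompact_piPresentation_H h39𝒢.toProp36Hypotheses.isCountable T𝒢 R𝒢 w𝒢
  have hPℋ' := isArithCompatible_piPresentation_outerAction_of_branchPair_chart_of_finite Dℋ h39ℋ.toProp36Hypotheses.isCountable hcofℋ h39ℋ.toProp36Hypotheses.isConnected hSℋ hfinℋ hneℋ Tℋ Rℋ ρℋ baseActℋ h39ℋ.thm37Hypotheses h39ℋ.isGraph hVℋ hBRℋ
  have hKLℋ' := Dℋ.hKst_and_hLst_of_ker_piLevelAut_eq_charOpenCore h39ℋ.toProp36Hypotheses.isCountable hconnℋ Tℋ Rℋ ρℋ hPℋ' dℋ hkerℋ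
  have hK1ℋ' := GaloisLevelData.hK1'_chart_of_eventually_congruenceContinuous_of_hself Dℋ h39ℋ.toProp36Hypotheses.isCountable hcofℋ h39ℋ.toProp36Hypotheses.isConnected hSℋ hfinℋ hneℋ hconnℋ ρℋ baseActℋ Tℋ Rℋ
    hPℋ' dℋ hkerℋ h39ℋ.isGraph nℋ hselfℋ hCCℋ
  have hcptℋ' := Dℋ.isCompact_piPresentation_H h39ℋ.toProp36Hypotheses.isCountable Tℋ Rℋ wℋ
  haveI hfc𝒢 : FirstCountableTopology (D𝒢.chart h39𝒢.toProp36Hypotheses.isCountable hcof𝒢 h39𝒢.toProp36Hypotheses.isConnected hS𝒢 hfin𝒢 hne𝒢).G := TemperedPiChart.firstCountableTopology_G _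
  haveI hfcℋ : FirstCountableTopology (Dℋ.chart h39ℋ.toProp36Hypotheses.isCountable hcofℋ h39ℋ.toProp36Hypotheses.isConnected hSℋ hfinℋ hneℋ).G := TemperedPiChart.firstCountableTopology_G _
  letI : TopologicalSpace (outerSemidirectProduct ρ𝒢) := arithLevelTopology (D𝒢.chart h39𝒢.toProp36Hypotheses.isCountable hcof𝒢 h39𝒢.toProp36Hypotheses.isConnected hS𝒢 hfin𝒢 hne𝒢) ρ𝒢 baseAct𝒢 h39𝒢.toProp36Hypotheses IsTempered.of_profinite (D𝒢.piPresentation h39𝒢.toProp36Hypotheses.isCountable T𝒢 R𝒢) hP𝒢' w𝒢 hcpt𝒢'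
      (fun n => (D𝒢.projAut h39𝒢.toProp36Hypotheses.isCountable n).ker) (fun _ => MonoidHom.normal_ker _) hKL𝒢'.1 (D𝒢.ker_projAut_anti h39𝒢.toProp36Hypotheses.isCountable)
      (D𝒢.isOpen_ker_projAut h39𝒢.toProp36Hypotheses.isCountable) (fun _ hU => D𝒢.exists_ker_projAut_subset h39𝒢.toProp36Hypotheses.isCountable hU) hK1𝒢'
  letI : TopologicalSpace (outerSemidirectProduct ρℋ) := arithLevelTopology (Dℋ.chart h39ℋ.toProp36Hypotheses.isCountable hcofℋ h39ℋ.toProp36Hypotheses.isConnected hSℋ hfinℋ hneℋ) ρℋ baseActℋ h39ℋ.toProp36Hypotheses IsTempered.of_profinite (Dℋ.piPresentation h39ℋ.toProp36Hypotheses.isCountable Tℋ Rℋ) hPℋ' wℋ hcptℋ'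
      (fun n => (Dℋ.projAut h39ℋ.toProp36Hypotheses.isCountable n).ker) (fun _ => MonoidHom.normal_ker _) hKLℋ'.1 (Dℋ.ker_projAut_anti h39ℋ.toProp36Hypotheses.isCountable)
      (Dℋ.isOpen_ker_projAut h39ℋ.toProp36Hypotheses.isCountable) (fun _ hU => Dℋ.exists_ker_projAut_subset h39ℋ.toProp36Hypotheses.isCountable hU) hK1ℋ'
  haveI := arithLevelTopology_isTopologicalGroup (D𝒢.chart h39𝒢.toProp36Hypotheses.isCountable hcof𝒢 h39𝒢.toProp36Hypotheses.isConnected hS𝒢 hfin𝒢 hne𝒢) ρ𝒢 baseAct𝒢 h39𝒢.toProp36Hypotheses IsTempered.of_profinite (D𝒢.piPresentation h39𝒢.toProp36Hypotheses.isCountable T𝒢 R𝒢) hP𝒢' w𝒢 hcpt𝒢'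
      (fun n => (D𝒢.projAut h39𝒢.toProp36Hypotheses.isCountable n).ker) (fun _ => MonoidHom.normal_ker _) hKL𝒢'.1 (D𝒢.ker_projAut_anti h39𝒢.toProp36Hypotheses.isCountable)
      (D𝒢.isOpen_ker_projAut h39𝒢.toProp36Hypotheses.isCountable) (fun _ hU => D𝒢.exists_ker_projAut_subset h39𝒢.toProp36Hypotheses.isCountable hU) hK1𝒢'
  haveI := arithLevelTopology_isTopologicalGroup (Dℋ.chart h39ℋ.toProp36Hypotheses.isCountable hcofℋ h39ℋ.toProp36Hypotheses.isConnected hSℋ hfinℋ hneℋ) ρℋ baseActℋ h39ℋ.toProp36Hypotheses IsTempered.of_profinite (Dℋ.piPresentation h39ℋ.toProp36Hypotheses.isCountable Tℋ Rℋ) hPℋ' wℋ hcptℋ'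
      (fun n => (Dℋ.projAut h39ℋ.toProp36Hypotheses.isCountable n).ker) (fun _ => MonoidHom.normal_ker _) hKLℋ'.1 (Dℋ.ker_projAut_anti h39ℋ.toProp36Hypotheses.isCountable)
      (Dℋ.isOpen_ker_projAut h39ℋ.toProp36Hypotheses.isCountable) (fun _ hU => Dℋ.exists_ker_projAut_subset h39ℋ.toProp36Hypotheses.isCountable hU) hK1ℋ'
  -- kernel normality at the chart's group structure (instance pin, as in p442253)
  haveI : ∀ n : ℕ, @Subgroup.Normal (D𝒢.chart h39𝒢.toProp36Hypotheses.isCountable hcof𝒢 h39𝒢.toProp36Hypotheses.isConnected hS𝒢 hfin𝒢 hne𝒢).G (D𝒢.chart h39𝒢.toProp36Hypotheses.isCountable hcof𝒢 h39𝒢.toProp36Hypotheses.isConnected hS𝒢 hfin𝒢 hne𝒢).group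
      ((D𝒢.projAut h39𝒢.toProp36Hypotheses.isCountable n).ker) := fun _ => MonoidHom.normal_ker _
  haveI : ∀ n : ℕ, @Subgroup.Normal (D𝒢.chart h39𝒢.toProp36Hypotheses.isCountable hcof𝒢 h39𝒢.toProp36Hypotheses.isConnected hS𝒢 hfin𝒢 hne𝒢).G (D𝒢.chart h39𝒢.toProp36Hypotheses.isCountable hcof𝒢 h39𝒢.toProp36Hypotheses.isConnected hS𝒢 hfin𝒢 hne𝒢).group
      ((D𝒢.piLevelAut h39𝒢.toProp36Hypotheses.isCountable hconn𝒢 n).ker) := fun _ => MonoidHom.normal_ker _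
  haveI : ∀ n : ℕ, @Subgroup.Normal (Dℋ.chart h39ℋ.toProp36Hypotheses.isCountable hcofℋ h39ℋ.toProp36Hypotheses.isConnected hSℋ hfinℋ hneℋ).G (Dℋ.chart h39ℋ.toProp36Hypotheses.isCountable hcofℋ h39ℋ.toProp36Hypotheses.isConnected hSℋ hfinℋ hneℋ).group
      ((Dℋ.projAut h39ℋ.toProp36Hypotheses.isCountable n).ker) := fun _ => MonoidHom.normal_ker _
  haveI : ∀ n : ℕ, @Subgroup.Normal (Dℋ.chart h39ℋ.toProp36Hypotheses.isCountable hcofℋ h39ℋ.toProp36Hypotheses.isConnected hSℋ hfinℋ hneℋ).G (Dℋ.chart h39ℋ.toProp36Hypotheses.isCountable hcofℋ h39ℋ.toProp36Hypotheses.isConnected hSℋ hfinℋ hneℋ).group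
      ((Dℋ.piLevelAut h39ℋ.toProp36Hypotheses.isCountable hconnℋ n).ker) := fun _ => MonoidHom.normal_ker _
  -- (AI4″) on both sides (abc-iut-w4-d059)
  have stab𝒢 := (stabBranchPairAug_chart_outerAction_modKernel D𝒢 h39𝒢.toProp36Hypotheses.isCountable hcof𝒢 h39𝒢.toProp36Hypotheses.isConnected hS𝒢 hfin𝒢 hne𝒢 hconn𝒢
      h39𝒢.thm37Hypotheses T𝒢 R𝒢 ρ𝒢 baseAct𝒢 hP𝒢' hKL𝒢'.2
      (continuous_outerSemidirectProductSnd (D𝒢.chart h39𝒢.toProp36Hypotheses.isCountable hcof𝒢 h39𝒢.toProp36Hypotheses.isConnected hS𝒢 hfin𝒢 hne𝒢) ρ𝒢 baseAct𝒢 h39𝒢.toProp36Hypotheses IsTempered.of_profinite (D𝒢.piPresentation h39𝒢.toProp36Hypotheses.isCountable T𝒢 R𝒢) hP𝒢' w𝒢 hcpt𝒢'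
      (fun n => (D𝒢.projAut h39𝒢.toProp36Hypotheses.isCountable n).ker) (fun _ => MonoidHom.normal_ker _) hKL𝒢'.1 (D𝒢.ker_projAut_anti h39𝒢.toProp36Hypotheses.isCountable)
      (D𝒢.isOpen_ker_projAut h39𝒢.toProp36Hypotheses.isCountable) (fun _ hU => D𝒢.exists_ker_projAut_subset h39𝒢.toProp36Hypotheses.isCountable hU) hK1𝒢')
      Rc𝒢 hRcV𝒢 hRcB𝒢
      (fun n => isOpen_ker_arithAct_of_le (D𝒢.chart h39𝒢.toProp36Hypotheses.isCountable hcof𝒢 h39𝒢.toProp36Hypotheses.isConnected hS𝒢 hfin𝒢 hne𝒢) ρ𝒢 baseAct𝒢 h39𝒢.toProp36Hypotheses IsTempered.of_profinite (D𝒢.piPresentation h39𝒢.toProp36Hypotheses.isCountable T𝒢 R𝒢) hP𝒢' w𝒢 hcpt𝒢'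
      (fun n => (D𝒢.projAut h39𝒢.toProp36Hypotheses.isCountable n).ker) (fun _ => MonoidHom.normal_ker _) hKL𝒢'.1 (D𝒢.ker_projAut_anti h39𝒢.toProp36Hypotheses.isCountable)
      (D𝒢.isOpen_ker_projAut h39𝒢.toProp36Hypotheses.isCountable) (fun _ hU => D𝒢.exists_ker_projAut_subset h39𝒢.toProp36Hypotheses.isCountable hU) hK1𝒢'
        (hKL𝒢'.2 n) (D𝒢.ker_projAut_le_ker_piLevelAut h39𝒢.toProp36Hypotheses.isCountable hconn𝒢 n))
      (hVc_of_cosetTower (D𝒢.chart h39𝒢.toProp36Hypotheses.isCountable hcof𝒢 h39𝒢.toProp36Hypotheses.isConnected hS𝒢 hfin𝒢 hne𝒢) (D𝒢.piPresentation h39𝒢.toProp36Hypotheses.isCountable T𝒢 R𝒢) hP𝒢' (toOuterSemidirectProduct ρ𝒢) (outerAction_exact (D𝒢.chart h39𝒢.toProp36Hypotheses.isCountable hcof𝒢 h39𝒢.toProp36Hypotheses.isConnected hS𝒢 hfin𝒢 hne𝒢) ρ𝒢 h39𝒢.toProp36Hypotheses).1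
        (fun e x => conj_toOuterSemidirectProduct ρ𝒢 e x) (fun _ => rfl) hισ𝒢
        (fun w' => by
        rw [D𝒢.piPresentation_H h39𝒢.toProp36Hypotheses.isCountable T𝒢 R𝒢]
        exact (T𝒢 w').range_decompHom_mem_verticialSubgroups_chart hcof𝒢 h39𝒢.toProp36Hypotheses.isConnected hS𝒢 hfin𝒢 hne𝒢)
        Rc𝒢 hRcV𝒢 (fun n => (D𝒢.projAut h39𝒢.toProp36Hypotheses.isCountable n).ker) hKL𝒢'.1
        (D𝒢.piPresentation_hHK h39𝒢.toProp36Hypotheses.isCountable T𝒢 R𝒢) h39𝒢.thm37Hypotheses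
        (isOpen_ker_arithAct (D𝒢.chart h39𝒢.toProp36Hypotheses.isCountable hcof𝒢 h39𝒢.toProp36Hypotheses.isConnected hS𝒢 hfin𝒢 hne𝒢) ρ𝒢 baseAct𝒢 h39𝒢.toProp36Hypotheses IsTempered.of_profinite (D𝒢.piPresentation h39𝒢.toProp36Hypotheses.isCountable T𝒢 R𝒢) hP𝒢' w𝒢 hcpt𝒢'
      (fun n => (D𝒢.projAut h39𝒢.toProp36Hypotheses.isCountable n).ker) (fun _ => MonoidHom.normal_ker _) hKL𝒢'.1 (D𝒢.ker_projAut_anti h39𝒢.toProp36Hypotheses.isCountable)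
      (D𝒢.isOpen_ker_projAut h39𝒢.toProp36Hypotheses.isCountable) (fun _ hU => D𝒢.exists_ker_projAut_subset h39𝒢.toProp36Hypotheses.isCountable hU) hK1𝒢')
        (isTempered_arithLevelTopology (D𝒢.chart h39𝒢.toProp36Hypotheses.isCountable hcof𝒢 h39𝒢.toProp36Hypotheses.isConnected hS𝒢 hfin𝒢 hne𝒢) ρ𝒢 baseAct𝒢 h39𝒢.toProp36Hypotheses IsTempered.of_profinite (D𝒢.piPresentation h39𝒢.toProp36Hypotheses.isCountable T𝒢 R𝒢) hP𝒢' w𝒢 hcpt𝒢'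
      (fun n => (D𝒢.projAut h39𝒢.toProp36Hypotheses.isCountable n).ker) (fun _ => MonoidHom.normal_ker _) hKL𝒢'.1 (D𝒢.ker_projAut_anti h39𝒢.toProp36Hypotheses.isCountable)
      (D𝒢.isOpen_ker_projAut h39𝒢.toProp36Hypotheses.isCountable) (fun _ hU => D𝒢.exists_ker_projAut_subset h39𝒢.toProp36Hypotheses.isCountable hU) hK1𝒢')
        (outerSemidirectProductSnd ρ𝒢)
        (arithLevelTopology_nhds_hasBasis (D𝒢.chart h39𝒢.toProp36Hypotheses.isCountable hcof𝒢 h39𝒢.toProp36Hypotheses.isConnected hS𝒢 hfin𝒢 hne𝒢) ρ𝒢 baseAct𝒢 h39𝒢.toProp36Hypotheses IsTempered.of_profinite (D𝒢.piPresentation h39𝒢.toProp36Hypotheses.isCountable T𝒢 R𝒢) hP𝒢' w𝒢 hcpt𝒢'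
      (fun n => (D𝒢.projAut h39𝒢.toProp36Hypotheses.isCountable n).ker) (fun _ => MonoidHom.normal_ker _) hKL𝒢'.1 (D𝒢.ker_projAut_anti h39𝒢.toProp36Hypotheses.isCountable)
      (D𝒢.isOpen_ker_projAut h39𝒢.toProp36Hypotheses.isCountable) (fun _ hU => D𝒢.exists_ker_projAut_subset h39𝒢.toProp36Hypotheses.isCountable hU) hK1𝒢')
        (le_of_eq (outerAction_exact (D𝒢.chart h39𝒢.toProp36Hypotheses.isCountable hcof𝒢 h39𝒢.toProp36Hypotheses.isConnected hS𝒢 hfin𝒢 hne𝒢) ρ𝒢 h39𝒢.toProp36Hypotheses).2.1.symm)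
        hK1𝒢'
        (D𝒢.isOpen_ker_projAut h39𝒢.toProp36Hypotheses.isCountable))
      (fun n => isClosed_map_ker_arithAct_arithLevelTopology (D𝒢.chart h39𝒢.toProp36Hypotheses.isCountable hcof𝒢 h39𝒢.toProp36Hypotheses.isConnected hS𝒢 hfin𝒢 hne𝒢) ρ𝒢 baseAct𝒢 (D𝒢.piPresentation h39𝒢.toProp36Hypotheses.isCountable T𝒢 R𝒢) hP𝒢' h39𝒢.toProp36Hypotheses IsTempered.of_profinite w𝒢 hcpt𝒢'
      (fun n => (D𝒢.projAut h39𝒢.toProp36Hypotheses.isCountable n).ker) (fun _ => MonoidHom.normal_ker _) hKL𝒢'.1 (D𝒢.ker_projAut_anti h39𝒢.toProp36Hypotheses.isCountable)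
      (D𝒢.isOpen_ker_projAut h39𝒢.toProp36Hypotheses.isCountable) (fun _ hU => D𝒢.exists_ker_projAut_subset h39𝒢.toProp36Hypotheses.isCountable hU) hK1𝒢'
        (hKL𝒢'.2 n) (D𝒢.ker_projAut_le_ker_piLevelAut h39𝒢.toProp36Hypotheses.isCountable hconn𝒢 n))
      (fun v₀ a ha => hU_arithVertGp_outerAction (D𝒢.chart h39𝒢.toProp36Hypotheses.isCountable hcof𝒢 h39𝒢.toProp36Hypotheses.isConnected hS𝒢 hfin𝒢 hne𝒢) ρ𝒢 baseAct𝒢 (D𝒢.piPresentation h39𝒢.toProp36Hypotheses.isCountable T𝒢 R𝒢) hP𝒢' (outerAction_exact (D𝒢.chart h39𝒢.toProp36Hypotheses.isCountable hcof𝒢 h39𝒢.toProp36Hypotheses.isConnected hS𝒢 hfin𝒢 hne𝒢) ρ𝒢 h39𝒢.toProp36Hypotheses).2.1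
        (fun n => (D𝒢.projAut h39𝒢.toProp36Hypotheses.isCountable n).ker)
        (D𝒢.ker_projAut_anti h39𝒢.toProp36Hypotheses.isCountable) hKL𝒢'.1
        (D𝒢.piPresentation_hHK h39𝒢.toProp36Hypotheses.isCountable T𝒢 R𝒢)
        (D𝒢.piPresentation_hlift h39𝒢.toProp36Hypotheses.isCountable T𝒢 R𝒢)
        (fun n => (D𝒢.piLevelAut h39𝒢.toProp36Hypotheses.isCountable hconn𝒢 n).ker) hKL𝒢'.2
        (D𝒢.ker_projAut_le_ker_piLevelAut h39𝒢.toProp36Hypotheses.isCountable hconn𝒢)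
        (D𝒢.isOpen_ker_piLevelAut h39𝒢.toProp36Hypotheses.isCountable hconn𝒢)
        (D𝒢.ker_piLevelAut_anti h39𝒢.toProp36Hypotheses.isCountable hconn𝒢)
        v₀ (D𝒢.isCompact_piPresentation_H h39𝒢.toProp36Hypotheses.isCountable T𝒢 R𝒢 v₀) Rc𝒢 hRcV𝒢 ha)
      (hnobpNCpt_cosetTower_of_faithV_chart D𝒢 h39𝒢.toProp36Hypotheses.isCountable hcof𝒢 h39𝒢.toProp36Hypotheses.isConnected hS𝒢 hfin𝒢 hne𝒢 hconn𝒢 T𝒢 R𝒢 h39𝒢.thm37Hypotheses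
        hP𝒢' hKL𝒢'.2 (toOuterSemidirectProduct ρ𝒢) (fun _ => rfl) (hισ𝒢) hfaithV𝒢))
  have stabℋ := (stabBranchPairAug_chart_outerAction_modKernel Dℋ h39ℋ.toProp36Hypotheses.isCountable hcofℋ h39ℋ.toProp36Hypotheses.isConnected hSℋ hfinℋ hneℋ hconnℋ
      h39ℋ.thm37Hypotheses Tℋ Rℋ ρℋ baseActℋ hPℋ' hKLℋ'.2
      (continuous_outerSemidirectProductSnd (Dℋ.chart h39ℋ.toProp36Hypotheses.isCountable hcofℋ h39ℋ.toProp36Hypotheses.isConnected hSℋ hfinℋ hneℋ) ρℋ baseActℋ h39ℋ.toProp36Hypotheses IsTempered.of_profinite (Dℋ.piPresentation h39ℋ.toProp36Hypotheses.isCountable Tℋ Rℋ) hPℋ' wℋ hcptℋ'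
      (fun n => (Dℋ.projAut h39ℋ.toProp36Hypotheses.isCountable n).ker) (fun _ => MonoidHom.normal_ker _) hKLℋ'.1 (Dℋ.ker_projAut_anti h39ℋ.toProp36Hypotheses.isCountable)
      (Dℋ.isOpen_ker_projAut h39ℋ.toProp36Hypotheses.isCountable) (fun _ hU => Dℋ.exists_ker_projAut_subset h39ℋ.toProp36Hypotheses.isCountable hU) hK1ℋ')
      Rcℋ hRcVℋ hRcBℋ
      (fun n => isOpen_ker_arithAct_of_le (Dℋ.chart h39ℋ.toProp36Hypotheses.isCountable hcofℋ h39ℋ.toProp36Hypotheses.isConnected hSℋ hfinℋ hneℋ) ρℋ baseActℋ h39ℋ.toProp36Hypotheses IsTempered.of_profinite (Dℋ.piPresentation h39ℋ.toProp36Hypotheses.isCountable Tℋ Rℋ) hPℋ' wℋ hcptℋ'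
      (fun n => (Dℋ.projAut h39ℋ.toProp36Hypotheses.isCountable n).ker) (fun _ => MonoidHom.normal_ker _) hKLℋ'.1 (Dℋ.ker_projAut_anti h39ℋ.toProp36Hypotheses.isCountable)
      (Dℋ.isOpen_ker_projAut h39ℋ.toProp36Hypotheses.isCountable) (fun _ hU => Dℋ.exists_ker_projAut_subset h39ℋ.toProp36Hypotheses.isCountable hU) hK1ℋ'
        (hKLℋ'.2 n) (Dℋ.ker_projAut_le_ker_piLevelAut h39ℋ.toProp36Hypotheses.isCountable hconnℋ n))
      (hVc_of_cosetTower (Dℋ.chart h39ℋ.toProp36Hypotheses.isCountable hcofℋ h39ℋ.toProp36Hypotheses.isConnected hSℋ hfinℋ hneℋ) (Dℋ.piPresentation h39ℋ.toProp36Hypotheses.isCountable Tℋ Rℋ) hPℋ' (toOuterSemidirectProduct ρℋ) (outerAction_exact (Dℋ.chart h39ℋ.toProp36Hypotheses.isCountable hcofℋ h39ℋ.toProp36Hypotheses.isConnected hSℋ hfinℋ hneℋ) ρℋ h39ℋ.toProp36Hypotheses).1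
        (fun e x => conj_toOuterSemidirectProduct ρℋ e x) (fun _ => rfl) hισℋ
        (fun w' => by
        rw [Dℋ.piPresentation_H h39ℋ.toProp36Hypotheses.isCountable Tℋ Rℋ]
        exact (Tℋ w').range_decompHom_mem_verticialSubgroups_chart hcofℋ h39ℋ.toProp36Hypotheses.isConnected hSℋ hfinℋ hneℋ)
        Rcℋ hRcVℋ (fun n => (Dℋ.projAut h39ℋ.toProp36Hypotheses.isCountable n).ker) hKLℋ'.1
        (Dℋ.piPresentation_hHK h39ℋ.toProp36Hypotheses.isCountable Tℋ Rℋ) h39ℋ.thm37Hypotheses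
        (isOpen_ker_arithAct (Dℋ.chart h39ℋ.toProp36Hypotheses.isCountable hcofℋ h39ℋ.toProp36Hypotheses.isConnected hSℋ hfinℋ hneℋ) ρℋ baseActℋ h39ℋ.toProp36Hypotheses IsTempered.of_profinite (Dℋ.piPresentation h39ℋ.toProp36Hypotheses.isCountable Tℋ Rℋ) hPℋ' wℋ hcptℋ'
      (fun n => (Dℋ.projAut h39ℋ.toProp36Hypotheses.isCountable n).ker) (fun _ => MonoidHom.normal_ker _) hKLℋ'.1 (Dℋ.ker_projAut_anti h39ℋ.toProp36Hypotheses.isCountable)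
      (Dℋ.isOpen_ker_projAut h39ℋ.toProp36Hypotheses.isCountable) (fun _ hU => Dℋ.exists_ker_projAut_subset h39ℋ.toProp36Hypotheses.isCountable hU) hK1ℋ')
        (isTempered_arithLevelTopology (Dℋ.chart h39ℋ.toProp36Hypotheses.isCountable hcofℋ h39ℋ.toProp36Hypotheses.isConnected hSℋ hfinℋ hneℋ) ρℋ baseActℋ h39ℋ.toProp36Hypotheses IsTempered.of_profinite (Dℋ.piPresentation h39ℋ.toProp36Hypotheses.isCountable Tℋ Rℋ) hPℋ' wℋ hcptℋ'
      (fun n => (Dℋ.projAut h39ℋ.toProp36Hypotheses.isCountable n).ker) (fun _ => MonoidHom.normal_ker _) hKLℋ'.1 (Dℋ.ker_projAut_anti h39ℋ.toProp36Hypotheses.isCountable)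
      (Dℋ.isOpen_ker_projAut h39ℋ.toProp36Hypotheses.isCountable) (fun _ hU => Dℋ.exists_ker_projAut_subset h39ℋ.toProp36Hypotheses.isCountable hU) hK1ℋ')
        (outerSemidirectProductSnd ρℋ)
        (arithLevelTopology_nhds_hasBasis (Dℋ.chart h39ℋ.toProp36Hypotheses.isCountable hcofℋ h39ℋ.toProp36Hypotheses.isConnected hSℋ hfinℋ hneℋ) ρℋ baseActℋ h39ℋ.toProp36Hypotheses IsTempered.of_profinite (Dℋ.piPresentation h39ℋ.toProp36Hypotheses.isCountable Tℋ Rℋ) hPℋ' wℋ hcptℋ'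
      (fun n => (Dℋ.projAut h39ℋ.toProp36Hypotheses.isCountable n).ker) (fun _ => MonoidHom.normal_ker _) hKLℋ'.1 (Dℋ.ker_projAut_anti h39ℋ.toProp36Hypotheses.isCountable)
      (Dℋ.isOpen_ker_projAut h39ℋ.toProp36Hypotheses.isCountable) (fun _ hU => Dℋ.exists_ker_projAut_subset h39ℋ.toProp36Hypotheses.isCountable hU) hK1ℋ')
        (le_of_eq (outerAction_exact (Dℋ.chart h39ℋ.toProp36Hypotheses.isCountable hcofℋ h39ℋ.toProp36Hypotheses.isConnected hSℋ hfinℋ hneℋ) ρℋ h39ℋ.toProp36Hypotheses).2.1.symm)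
        hK1ℋ'
        (Dℋ.isOpen_ker_projAut h39ℋ.toProp36Hypotheses.isCountable))
      (fun n => isClosed_map_ker_arithAct_arithLevelTopology (Dℋ.chart h39ℋ.toProp36Hypotheses.isCountable hcofℋ h39ℋ.toProp36Hypotheses.isConnected hSℋ hfinℋ hneℋ) ρℋ baseActℋ (Dℋ.piPresentation h39ℋ.toProp36Hypotheses.isCountable Tℋ Rℋ) hPℋ' h39ℋ.toProp36Hypotheses IsTempered.of_profinite wℋ hcptℋ'
      (fun n => (Dℋ.projAut h39ℋ.toProp36Hypotheses.isCountable n).ker) (fun _ => MonoidHom.normal_ker _) hKLℋ'.1 (Dℋ.ker_projAut_anti h39ℋ.toProp36Hypotheses.isCountable)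
      (Dℋ.isOpen_ker_projAut h39ℋ.toProp36Hypotheses.isCountable) (fun _ hU => Dℋ.exists_ker_projAut_subset h39ℋ.toProp36Hypotheses.isCountable hU) hK1ℋ'
        (hKLℋ'.2 n) (Dℋ.ker_projAut_le_ker_piLevelAut h39ℋ.toProp36Hypotheses.isCountable hconnℋ n))
      (fun v₀ a ha => hU_arithVertGp_outerAction (Dℋ.chart h39ℋ.toProp36Hypotheses.isCountable hcofℋ h39ℋ.toProp36Hypotheses.isConnected hSℋ hfinℋ hneℋ) ρℋ baseActℋ (Dℋ.piPresentation h39ℋ.toProp36Hypotheses.isCountable Tℋ Rℋ) hPℋ' (outerAction_exact (Dℋ.chart h39ℋ.toProp36Hypotheses.isCountable hcofℋ h39ℋ.toProp36Hypotheses.isConnected hSℋ hfinℋ hneℋ) ρℋ h39ℋ.toProp36Hypotheses).2.1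
        (fun n => (Dℋ.projAut h39ℋ.toProp36Hypotheses.isCountable n).ker)
        (Dℋ.ker_projAut_anti h39ℋ.toProp36Hypotheses.isCountable) hKLℋ'.1
        (Dℋ.piPresentation_hHK h39ℋ.toProp36Hypotheses.isCountable Tℋ Rℋ)
        (Dℋ.piPresentation_hlift h39ℋ.toProp36Hypotheses.isCountable Tℋ Rℋ)
        (fun n => (Dℋ.piLevelAut h39ℋ.toProp36Hypotheses.isCountable hconnℋ n).ker) hKLℋ'.2
        (Dℋ.ker_projAut_le_ker_piLevelAut h39ℋ.toProp36Hypotheses.isCountable hconnℋ)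
        (Dℋ.isOpen_ker_piLevelAut h39ℋ.toProp36Hypotheses.isCountable hconnℋ)
        (Dℋ.ker_piLevelAut_anti h39ℋ.toProp36Hypotheses.isCountable hconnℋ)
        v₀ (Dℋ.isCompact_piPresentation_H h39ℋ.toProp36Hypotheses.isCountable Tℋ Rℋ v₀) Rcℋ hRcVℋ ha)
      (hnobpNCpt_cosetTower_of_faithV_chart Dℋ h39ℋ.toProp36Hypotheses.isCountable hcofℋ h39ℋ.toProp36Hypotheses.isConnected hSℋ hfinℋ hneℋ hconnℋ Tℋ Rℋ h39ℋ.thm37Hypotheses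
        hPℋ' hKLℋ'.2 (toOuterSemidirectProduct ρℋ) (fun _ => rfl) (hισℋ) hfaithVℋ))
  exact arithThm54_outerModels_chart_of_producers_of_congruenceContinuous
    h39𝒢 D𝒢 hcof𝒢 hS𝒢 hfin𝒢 hne𝒢 hconn𝒢 ρ𝒢 baseAct𝒢 T𝒢 R𝒢 Rc𝒢 hV𝒢 hE𝒢 hopen𝒢 hBR𝒢 w𝒢 d𝒢 hker𝒢 hfaithV𝒢 n𝒢 hself𝒢 hCC𝒢 rfl noSwitch𝒢 stab𝒢 hest𝒢 hbot𝒢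
    h39ℋ Dℋ hcofℋ hSℋ hfinℋ hneℋ hconnℋ ρℋ baseActℋ Tℋ Rℋ Rcℋ hVℋ hEℋ hopenℋ hBRℋ wℋ dℋ hkerℋ hfaithVℋ nℋ hselfℋ hCCℋ rfl noSwitchℋ stabℋ hestℋ hbotℋ
    btemp hcont hover dict θd hlo φc hφc hfaith hfull F𝒢 θ𝒢 hrep𝒢 hpre Fℋ θℋ hrepℋ hpost hbtempφ he

end Literature.AnabelianGeometry.SemiGraphs
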